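import Summits.FinalStateConjecture.FinalStateConjecture.Theses.HarmonicFluxCensus
import Literature.Geometry.Lorentzian.MaximalDataScalarCurvature
import Literature.Geometry.Lorentzian.AsymptoticFlatness

open scoped Manifold ContDiff Topology BigOperators ENNReal Classical
open Set Filter MeasureTheory

noncomputable section

namespace Summit.FinalStateConjecture.FinalStateConjecture.Cruxes.BoundedCensusGeometry.Split

/-!
# Birth skeleton of piece 1 `MaximalLeafDominance` (split of `BoundedCensusGeometry`, stmt-17468)

Two registered stubs and the kernel-checked composition `MaximalLeafDominance_of`.
-/

/-- Piece 1 of the split (verbatim the child statement to be filed on the route). -/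
def MaximalLeafDominance : Prop :=
  ∀ (X : Type) [TopologicalSpace X] [ChartedSpace (EuclideanSpace ℝ (Fin 3)) X] [IsManifold (𝓡 3) ((⊤ : ENat) : WithTop ENat) X] [T2Space X] [SecondCountableTopology X] [ConnectedSpace X] (D : Literature.Geometry.Lorentzian.InitialDataSet (𝓡 3) X), D ∈ Literature.Geometry.Lorentzian.admissibleVacuumData X → ∀ 𝒟 : Literature.Geometry.Lorentzian.VacuumCauchyDevelopment D, 𝒟.IsMaximal → ∃ c₁ Q₀ : ℝ, ∀ (X' : Type) [TopologicalSpace X'] [ChartedSpace (EuclideanSpace ℝ (Fin 3)) X'] [IsManifold (𝓡 3) ((⊤ : ENat) : WithTop ENat) X'] [ConnectedSpace X'] (D' : Literature.Geometry.Lorentzian.InitialDataSet (𝓡 3) X') (𝒟' : Literature.Geometry.Lorentzian.CauchyDevelopment D'), 𝒟'.toSpacetime = 𝒟.toSpacetime → ∀ (m : ℕ) (S : Fin m → Literature.Geometry.Lorentzian.OutermostMOTS (𝓡 3) D'.h D'.k), (∀ j, ConnectedSpace (S j).surf) → (∀ j, IsCompact (((S j).exterior : Set X'))ᶜ ∧ (interior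 (((S j).exterior : Set X'))ᶜ).Nonempty) → Pairwise (fun j j' ↦ Disjoint (((S j).exterior : Set X'))ᶜ (((S j').exterior : Set X'))ᶜ) → ∃ (X'' : Type) (_ : TopologicalSpace X'') (_ : ChartedSpace (EuclideanSpace ℝ (Fin 3)) X'') (_ : IsManifold (𝓡 3) ((⊤ : ENat) : WithTop ENat) X'') (_ : T2Space X'') (_ : LocallyCompactSpace X'') (_ : MeasurableSpace X'') (_ : BorelSpace X'') (_ : ConnectedSpace X'') (D'' : Literature.Geometry.Lorentzian.InitialDataSet (𝓡 3) X'') (𝒟'' : Literature.Geometry.Lorentzian.CauchyDevelopment D'') (_ : D''.metric.HasLeviCivita), 𝒟''.toSpacetime = 𝒟.toSpacetime ∧ D''.IsComplete ∧ D''.IsMaximalData ∧ D''.IsVacuumConstraintSolution ∧ ∃ (m' : ℕ) (S'' : Fin m' → Literature.Geometry.Lorentzian.OutermostMOTS (𝓡 3) D''.h D''.k), m ≤ m' ∧ (∀ j, ConnectedSpace (S'' j).surf) ∧ (∀ j, IsCompact (((S'' j).exterior : Set X''))ᶜ ∧ (interior (((S'' j).exterior : Set X''))ᶜ).Nonempty)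 ∧ Pairwise (fun j j' ↦ Disjoint (((S'' j).exterior : Set X''))ᶜ (((S'' j').exterior : Set X''))ᶜ) ∧ (∀ ζ : X'' → ℝ, ContMDiff (𝓡 3) 𝓘(ℝ, ℝ) 1 ζ → HasCompactSupport ζ → (∫⁻ x in ⋂ j, ((S'' j).exterior : Set X''), ENNReal.ofReal (|ζ x| ^ 6) ∂(Literature.Geometry.Lorentzian.riemannianMeasure D''.h)) ^ (1 / 3 : ℝ) ≤ ENNReal.ofReal c₁ * ∫⁻ x in ⋂ j, ((S'' j).exterior : Set X''), ENNReal.ofReal (D''.metric.innerDual x (mvfderiv (𝓡 3) ζ x).toLinearMap (mvfderiv (𝓡 3) ζ x).toLinearMap) ∂(Literature.Geometry.Lorentzian.riemannianMeasure D''.h)) ∧ (∫⁻ x in ⋂ j, ((S'' j).exterior : Set X''), ENNReal.ofReal ((D''.metric.normSq x (D''.metric.ricci x)) ^ (3 / 4 : ℝ)) ∂(Literature.Geometry.Lorentzian.riemannianMeasure D''.h)) + ∑ j, (∫⁻ x in Set.range (S'' j).f, ENNReal.ofReal (D''.normSqK x) ∂(Literature.Geometry.Lorentzian.riemannianVolume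 D''.h 2)) ≤ ENNReal.ofReal Q₀

/-- **stub A — full-horizon maximal leaves dominate** (Lorentzian MOTT geometry; no cost): every
family of `m` disjoint compact bodies bounded by connected outermost MOTSs on ANY Cauchy slice of an
MGHD of admissible data is dominated (`m ≤ m'`) by a FULL body family — no further disjoint body in
the common exterior — on a COMPLETE MAXIMAL vacuum-constrained Cauchy slice of the same spacetime
(Bartnik 1984 existence of maximal slices; Andersson–Mars–Metzger–Simon 2009 MOTT propagation;
Andersson–Metzger 2009 outermost MOTS = boundary of the trapped region). -/
theorem stub_fullHorizonLeaf :
    ∀ (X : Type) [TopologicalSpace X] [ChartedSpace (EuclideanSpace ℝ (Fin 3)) X] [IsManifold (𝓡 3) ((⊤ : ENat) : WithTop ENat) X] [T2Space X] [SecondCountableTopology X] [ConnectedSpace X] (D : Literature.Geometry.Lorentzian.InitialDataSet (𝓡 3) X), D ∈ Literature.Geometry.Lorentzian.admissibleVacuumData X → ∀ 𝒟 : Literature.Geometry.Lorentzian.VacuumCauchyDevelopment D, 𝒟.IsMaximal → ∀ (X' : Type) [TopologicalSpace X'] [ChartedSpace (EuclideanSpace ℝ (Fin 3)) X'] [IsManifold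 (𝓡 3) ((⊤ : ENat) : WithTop ENat) X'] [ConnectedSpace X'] (D' : Literature.Geometry.Lorentzian.InitialDataSet (𝓡 3) X') (𝒟' : Literature.Geometry.Lorentzian.CauchyDevelopment D'), 𝒟'.toSpacetime = 𝒟.toSpacetime → ∀ (m : ℕ) (S : Fin m → Literature.Geometry.Lorentzian.OutermostMOTS (𝓡 3) D'.h D'.k), (∀ j, ConnectedSpace (S j).surf) → (∀ j, IsCompact (((S j).exterior : Set X'))ᶜ ∧ (interior (((S j).exterior : Set X'))ᶜ).Nonempty) → Pairwise (fun j j' ↦ Disjoint (((S j).exterior : Set X'))ᶜ (((S j').exterior : Set X'))ᶜ) → ∃ (X'' : Type) (_ : TopologicalSpace X'') (_ : ChartedSpace (EuclideanSpace ℝ (Fin 3)) X'') (_ : IsManifold (𝓡 3) ((⊤ : ENat) : WithTop ENat) X'') (_ : T2Space X'') (_ : LocallyCompactSpace X'') (_ : MeasurableSpace X'') (_ : BorelSpace X'') (_ : ConnectedSpace X'') (D'' : Literature.Geometry.Lorentzian.InitialDataSet (𝓡 3) X'') (𝒟'' : Literature.Geometry.Lorentzian.CauchyDevelopment D'') (_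 : D''.metric.HasLeviCivita), 𝒟''.toSpacetime = 𝒟.toSpacetime ∧ D''.IsComplete ∧ D''.IsMaximalData ∧ D''.IsVacuumConstraintSolution ∧ ∃ (m' : ℕ) (S'' : Fin m' → Literature.Geometry.Lorentzian.OutermostMOTS (𝓡 3) D''.h D''.k), m ≤ m' ∧ (∀ j, ConnectedSpace (S'' j).surf) ∧ (∀ j, IsCompact (((S'' j).exterior : Set X''))ᶜ ∧ (interior (((S'' j).exterior : Set X''))ᶜ).Nonempty) ∧ Pairwise (fun j j' ↦ Disjoint (((S'' j).exterior : Set X''))ᶜ (((S'' j').exterior : Set X''))ᶜ) ∧ (∀ T : Literature.Geometry.Lorentzian.OutermostMOTS (𝓡 3) D''.h D''.k, ConnectedSpace T.surf → IsCompact ((T.exterior : Set X''))ᶜ → (interior ((T.exterior : Set X''))ᶜ).Nonempty → ∃ j, ¬ Disjoint ((T.exterior : Set X''))ᶜ (((S'' j).exterior : Set X''))ᶜ) := by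
  sorry

/-- **stub B — uniform census cost of the untrapped exterior of maximal leaves** (Riemannian,
uniform in the leaf): for every MGHD of admissible data there are `(c₁, Q₀)` bounding the
Neumann–Sobolev constant and the census functional of the common exterior of every FULL body family
on every complete maximal vacuum-constrained Cauchy slice (the domain of outer communications seen
by the maximal leaves has bounded scale-free geometry, uniformly in time). -/
theorem stub_fullHorizonCost :
    ∀ (X : Type) [TopologicalSpace X] [ChartedSpace (EuclideanSpace ℝ (Fin 3)) X] [IsManifold (𝓡 3) ((⊤ : ENat) : WithTop ENat) X] [T2Space X] [SecondCountableTopology X] [ConnectedSpace X] (D : Literature.Geometry.Lorentzian.InitialDataSet (𝓡 3) X), D ∈ Literature.Geometry.Lorentzian.admissibleVacuumData X → ∀ 𝒟 : Literature.Geometry.Lorentzian.VacuumCauchyDevelopment D, 𝒟.IsMaximal → ∃ c₁ Q₀ : ℝ, ∀ (X'' : Type) [TopologicalSpace X''] [ChartedSpace (EuclideanSpace ℝ (Fin 3)) X''] [IsManifold (𝓡 3) ((⊤ : ENat) : WithTop ENat) X''] [T2Space X''] [LocallyCompactSpace X''] [MeasurableSpace X''] [BorelSpace X''] [ConnectedSpace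 X''] (D'' : Literature.Geometry.Lorentzian.InitialDataSet (𝓡 3) X'') (𝒟'' : Literature.Geometry.Lorentzian.CauchyDevelopment D''), (∀ [D''.metric.HasLeviCivita], 𝒟''.toSpacetime = 𝒟.toSpacetime → D''.IsComplete → D''.IsMaximalData → D''.IsVacuumConstraintSolution → ∀ (m' : ℕ) (S'' : Fin m' → Literature.Geometry.Lorentzian.OutermostMOTS (𝓡 3) D''.h D''.k), (∀ j, ConnectedSpace (S'' j).surf) → (∀ j, IsCompact (((S'' j).exterior : Set X''))ᶜ ∧ (interior (((S'' j).exterior : Set X''))ᶜ).Nonempty) → Pairwise (fun j j' ↦ Disjoint (((S'' j).exterior : Set X''))ᶜ (((S'' j').exterior : Set X''))ᶜ) → (∀ T : Literature.Geometry.Lorentzian.OutermostMOTS (𝓡 3) D''.h D''.k, ConnectedSpace T.surf → IsCompact ((T.exterior : Set X''))ᶜ → (interior ((T.exterior : Set X''))ᶜ).Nonempty → ∃ j, ¬ Disjoint ((T.exterior : Set X''))ᶜ (((S'' j).exterior : Set X''))ᶜ) → (∀ ζ : X'' → ℝ, ContMDiff (𝓡 3) 𝓘(ℝ, ℝ) 1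 ζ → HasCompactSupport ζ → (∫⁻ x in ⋂ j, ((S'' j).exterior : Set X''), ENNReal.ofReal (|ζ x| ^ 6) ∂(Literature.Geometry.Lorentzian.riemannianMeasure D''.h)) ^ (1 / 3 : ℝ) ≤ ENNReal.ofReal c₁ * ∫⁻ x in ⋂ j, ((S'' j).exterior : Set X''), ENNReal.ofReal (D''.metric.innerDual x (mvfderiv (𝓡 3) ζ x).toLinearMap (mvfderiv (𝓡 3) ζ x).toLinearMap) ∂(Literature.Geometry.Lorentzian.riemannianMeasure D''.h)) ∧ (∫⁻ x in ⋂ j, ((S'' j).exterior : Set X''), ENNReal.ofReal ((D''.metric.normSq x (D''.metric.ricci x)) ^ (3 / 4 : ℝ)) ∂(Literature.Geometry.Lorentzian.riemannianMeasure D''.h)) + ∑ j, (∫⁻ x in Set.range (S'' j).f, ENNReal.ofReal (D''.normSqK x) ∂(Literature.Geometry.Lorentzian.riemannianVolume D''.h 2)) ≤ ENNReal.ofReal Q₀) := by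
  sorry

/-- **Composition** `stub A → stub B → MaximalLeafDominance` (kernel-checked). -/
theorem maximalLeafDominance_of_statements :
    (∀ (X : Type) [TopologicalSpace X] [ChartedSpace (EuclideanSpace ℝ (Fin 3)) X] [IsManifold (𝓡 3) ((⊤ : ENat) : WithTop ENat) X] [T2Space X] [SecondCountableTopology X] [ConnectedSpace X] (D : Literature.Geometry.Lorentzian.InitialDataSet (𝓡 3) X), D ∈ Literature.Geometry.Lorentzian.admissibleVacuumData X → ∀ 𝒟 : Literature.Geometry.Lorentzian.VacuumCauchyDevelopment D, 𝒟.IsMaximal → ∀ (X' : Type) [TopologicalSpace X'] [ChartedSpace (EuclideanSpace ℝ (Fin 3)) X'] [IsManifold (𝓡 3) ((⊤ : ENat) : WithTop ENat) X'] [ConnectedSpace X'] (D' : Literature.Geometry.Lorentzian.InitialDataSet (𝓡 3) X') (𝒟' : Literature.Geometry.Lorentzian.CauchyDevelopment D'), 𝒟'.toSpacetime = 𝒟.toSpacetime → ∀ (m : ℕ) (S : Fin m → Literature.Geometry.Lorentzian.OutermostMOTS (𝓡 3) D'.h D'.k), (∀ j, ConnectedSpace (S j).surf) → (∀ j, IsCompact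 (((S j).exterior : Set X'))ᶜ ∧ (interior (((S j).exterior : Set X'))ᶜ).Nonempty) → Pairwise (fun j j' ↦ Disjoint (((S j).exterior : Set X'))ᶜ (((S j').exterior : Set X'))ᶜ) → ∃ (X'' : Type) (_ : TopologicalSpace X'') (_ : ChartedSpace (EuclideanSpace ℝ (Fin 3)) X'') (_ : IsManifold (𝓡 3) ((⊤ : ENat) : WithTop ENat) X'') (_ : T2Space X'') (_ : LocallyCompactSpace X'') (_ : MeasurableSpace X'') (_ : BorelSpace X'') (_ : ConnectedSpace X'') (D'' : Literature.Geometry.Lorentzian.InitialDataSet (𝓡 3) X'') (𝒟'' : Literature.Geometry.Lorentzian.CauchyDevelopment D'') (_ : D''.metric.HasLeviCivita), 𝒟''.toSpacetime = 𝒟.toSpacetime ∧ D''.IsComplete ∧ D''.IsMaximalData ∧ D''.IsVacuumConstraintSolution ∧ ∃ (m' : ℕ) (S'' : Fin m' → Literature.Geometry.Lorentzian.OutermostMOTS (𝓡 3) D''.h D''.k), m ≤ m' ∧ (∀ j, ConnectedSpace (S'' j).surf) ∧ (∀ j, IsCompact (((S'' j).exterior : Set X''))ᶜ ∧ (interior (((S''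 j).exterior : Set X''))ᶜ).Nonempty) ∧ Pairwise (fun j j' ↦ Disjoint (((S'' j).exterior : Set X''))ᶜ (((S'' j').exterior : Set X''))ᶜ) ∧ (∀ T : Literature.Geometry.Lorentzian.OutermostMOTS (𝓡 3) D''.h D''.k, ConnectedSpace T.surf → IsCompact ((T.exterior : Set X''))ᶜ → (interior ((T.exterior : Set X''))ᶜ).Nonempty → ∃ j, ¬ Disjoint ((T.exterior : Set X''))ᶜ (((S'' j).exterior : Set X''))ᶜ)) →
    (∀ (X : Type) [TopologicalSpace X] [ChartedSpace (EuclideanSpace ℝ (Fin 3)) X] [IsManifold (𝓡 3) ((⊤ : ENat) : WithTop ENat) X] [T2Space X] [SecondCountableTopology X] [ConnectedSpace X] (D : Literature.Geometry.Lorentzian.InitialDataSet (𝓡 3) X), D ∈ Literature.Geometry.Lorentzian.admissibleVacuumData X → ∀ 𝒟 : Literature.Geometry.Lorentzian.VacuumCauchyDevelopment D, 𝒟.IsMaximal → ∃ c₁ Q₀ : ℝ, ∀ (X'' : Type) [TopologicalSpace X''] [ChartedSpace (EuclideanSpace ℝ (Fin 3)) X''] [IsManifold (𝓡 3) ((⊤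 : ENat) : WithTop ENat) X''] [T2Space X''] [LocallyCompactSpace X''] [MeasurableSpace X''] [BorelSpace X''] [ConnectedSpace X''] (D'' : Literature.Geometry.Lorentzian.InitialDataSet (𝓡 3) X'') (𝒟'' : Literature.Geometry.Lorentzian.CauchyDevelopment D''), (∀ [D''.metric.HasLeviCivita], 𝒟''.toSpacetime = 𝒟.toSpacetime → D''.IsComplete → D''.IsMaximalData → D''.IsVacuumConstraintSolution → ∀ (m' : ℕ) (S'' : Fin m' → Literature.Geometry.Lorentzian.OutermostMOTS (𝓡 3) D''.h D''.k), (∀ j, ConnectedSpace (S'' j).surf) → (∀ j, IsCompact (((S'' j).exterior : Set X''))ᶜ ∧ (interior (((S'' j).exterior : Set X''))ᶜ).Nonempty) → Pairwise (fun j j' ↦ Disjoint (((S'' j).exterior : Set X''))ᶜ (((S'' j').exterior : Set X''))ᶜ) → (∀ T : Literature.Geometry.Lorentzian.OutermostMOTS (𝓡 3) D''.h D''.k, ConnectedSpace T.surf → IsCompact ((T.exterior : Set X''))ᶜ → (interior ((T.exterior : Set X''))ᶜ).Nonempty → ∃ j, ¬ Disjoint ((T.exterior : Set X''))ᶜ (((S''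 j).exterior : Set X''))ᶜ) → (∀ ζ : X'' → ℝ, ContMDiff (𝓡 3) 𝓘(ℝ, ℝ) 1 ζ → HasCompactSupport ζ → (∫⁻ x in ⋂ j, ((S'' j).exterior : Set X''), ENNReal.ofReal (|ζ x| ^ 6) ∂(Literature.Geometry.Lorentzian.riemannianMeasure D''.h)) ^ (1 / 3 : ℝ) ≤ ENNReal.ofReal c₁ * ∫⁻ x in ⋂ j, ((S'' j).exterior : Set X''), ENNReal.ofReal (D''.metric.innerDual x (mvfderiv (𝓡 3) ζ x).toLinearMap (mvfderiv (𝓡 3) ζ x).toLinearMap) ∂(Literature.Geometry.Lorentzian.riemannianMeasure D''.h)) ∧ (∫⁻ x in ⋂ j, ((S'' j).exterior : Set X''), ENNReal.ofReal ((D''.metric.normSq x (D''.metric.ricci x)) ^ (3 / 4 : ℝ)) ∂(Literature.Geometry.Lorentzian.riemannianMeasure D''.h)) + ∑ j, (∫⁻ x in Set.range (S'' j).f, ENNReal.ofReal (D''.normSqK x) ∂(Literature.Geometry.Lorentzian.riemannianVolume D''.h 2)) ≤ ENNReal.ofReal Q₀)) →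
      id MaximalLeafDominance := by
  intro hA hB
  show MaximalLeafDominance
  intro X _ _ _ _ _ _ D hD 𝒟 hmax
  obtain ⟨c₁, Q₀, hcost⟩ := hB X D hD 𝒟 hmax
  refine ⟨c₁, Q₀, fun X' _ _ _ _ D' 𝒟' h𝒟' m S hS hBd hdisj ↦ ?_⟩
  obtain ⟨X'', i₁, i₂, i₃, i₄, i₅, i₆, i₇, i₈, D'', 𝒟'', i₉, hsp, hcomp, hmaxd, hvac, m', S'', hmm', hS'',
    hB'', hdisj'', hfull⟩ := hA X D hD 𝒟 hmax X' D' 𝒟' h𝒟' m S hS hBd hdisj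
  obtain ⟨hsob, hQ⟩ := hcost X'' D'' 𝒟'' hsp hcomp hmaxd hvac m' S'' hS'' hB'' hdisj'' hfull
  exact ⟨X'', i₁, i₂, i₃, i₄, i₅, i₆, i₇, i₈, D'', 𝒟'', i₉, hsp, hcomp, hmaxd, hvac, m', S'', hmm', hS'',
    hB'', hdisj'', hsob, hQ⟩

/-- **Composition (skeleton theorem).** The piece `MaximalLeafDominance` BY NAME and without hypotheses, from the two stubs. -/
theorem MaximalLeafDominance_of : MaximalLeafDominance :=
  maximalLeafDominance_of_statements stub_fullHorizonLeaf stub_fullHorizonCost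

end Summit.FinalStateConjecture.FinalStateConjecture.Cruxes.BoundedCensusGeometry.Split

end
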